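import Literature.Computability.Complexity.Oracle
import Literature.Computability.Complexity.Randomized
import Mathlib.Data.Fintype.Pi
import Mathlib.Logic.Function.Basic
import HarnessLib

/-!
# Lazy sampling of a random oracle, I: runs with an answer rule, transcripts, the lazy rule

Toolkit for the discharge of Bennett–Gill's `ALMOST-P ⊆ BPP`
(`Literature.Computability.Complexity.almostP_subset_BPP`, `AlmostP.lean`): the coin-flip
simulation of an oracle machine run against a random oracle ("the machine's finitely many oracle
queries are answered by fresh fair coins, repeated queries consistently"; Bennett–Gill 1981;
Book–Vollmer–Wagner 1996, §3 Prop. 1: "for every `i` and `x`, the tree of all computations of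
`M_{f(i)}` on input `x` for the different oracles is obviously finite", whence the type-2
operator `BP²` is a classical `BP_h` operator over coin words).

In G01's transcript model (`Oracle.lean`: an oracle algorithm is a step function
`(input, answers so far) ↦ query | output`, run by `OracleAlg.runAux`) we introduce

* `OracleAlg.runWith M x ans k as` — the run in which the query `u` asked after transcript `as`
  is answered by the single bit `ans as u` (an *answer rule*, possibly history-dependent);
  `runAux_ofLanguage`: against a language oracle `A`, G01's runner is `runWith` for the
  history-free rule `[· ∈ A]`;
* `OracleAlg.traceT M x ans j` — the transcript after `j` rounds (frozen after the output), with
  its dynamics `nextT`, the halting criterion `runWith_nil_eq_some_iff`, well-formedness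
  `traceT_wf` (every entry is the rule's answer to the query asked there) and the **locality**
  principle `traceT_congr` (rules agreeing along a transcript produce it alike);
* the **lazy-sampling rule** `OracleAlg.coinAns M F τ x y`: a query in the finite set `F` is
  answered by the hard-wired table `τ`, a repeated query by its cached answer
  (`cachedAnswer`, recomputing the earlier queries `queryAt` by replaying the step function), a
  fresh query at round `|as|` by the coin `y[|as|]`; its consistency with history-free rules
  (`cachedAnswer_traceT_historyFree`) and coin locality (`traceT_coinAns_congr`);
* the counting lemma `two_mul_card_filter_eq` (an involution preserving `P` and flipping a bit
  halves `P`).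

The counting identity equating the coin world with the random-oracle world is in
`LazySamplingCount.lean`; its probability form in `LazySamplingUniform.lean`.

## References

* C. H. Bennett, J. Gill, *Relative to a random oracle `A`, `P^A ≠ NP^A ≠ co-NP^A` with
  probability 1*, SIAM J. Comput. 10 (1981) 96–113 [BennettGill1981].
* R. V. Book, H. Vollmer, K. W. Wagner, *On type-2 probabilistic quantifiers*, ICALP 1996,
  LNCS 1099 [BookVollmerWagner1996], §3 (Prop. 1, p. 373–374), §4 (Thm. 3, p. 374).
* S. Arora, B. Barak, *Computational Complexity: A Modern Approach*, CUP 2009, §3.4 (oracle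
  machines: the configuration after `i` answers is determined by the input and those answers).
-/

namespace Literature.Computability.Complexity

open _root_.Computability

namespace OracleAlg

variable {β : Type}

/-! ### Runs with an answer rule -/

/-- Run `M` on `x` for at most `k` rounds from the transcript `as`, answering the query `u` asked
after transcript `as` with the single bit `ans as u`. [folklore] -/
def runWith (M : OracleAlg β) (x : List Bool) (ans : List (List Bool) → List Bool → Bool) :
    ℕ → List (List Bool) → Option β
  | 0, _ => none
  | k + 1, as =>
    match M.step x as with
    | Sum.inl u => runWith M x ans k (as ++ [[ans as u]])
    | Sum.inr b => some b

/-- One round of the transcript dynamics under the answer rule `ans`. [folklore] -/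
def nextT (M : OracleAlg β) (x : List Bool) (ans : List (List Bool) → List Bool → Bool)
    (as : List (List Bool)) : List (List Bool) :=
  match M.step x as with
  | Sum.inl u => as ++ [[ans as u]]
  | Sum.inr _ => as

/-- The transcript after `j` rounds (frozen once the machine has output). [folklore] -/
def traceT (M : OracleAlg β) (x : List Bool) (ans : List (List Bool) → List Bool → Bool) :
    ℕ → List (List Bool)
  | 0 => []
  | j + 1 => nextT M x ans (traceT M x ans j)

variable (M : OracleAlg β) (x : List Bool) (ans : List (List Bool) → List Bool → Bool)

/-- No rounds, empty transcript. [folklore] -/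
@[simp] theorem traceT_zero : traceT M x ans 0 = [] := rfl

/-- One more round applies the dynamics `nextT`. [folklore] -/
theorem traceT_succ (j : ℕ) : traceT M x ans (j + 1) = nextT M x ans (traceT M x ans j) := rfl

/-- A query round appends the rule's answer. [folklore] -/
theorem nextT_of_inl {as : List (List Bool)} {u : List Bool} (h : M.step x as = Sum.inl u) :
    nextT M x ans as = as ++ [[ans as u]] := by
  simp [nextT, h]

/-- An output round leaves the transcript unchanged. [folklore] -/
theorem nextT_of_inr {as : List (List Bool)} {b : β} (h : M.step x as = Sum.inr b) :
    nextT M x ans as = as := by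
  simp [nextT, h]

/-- `runWith` from a transcript, in terms of iterated `nextT`. [folklore] -/
theorem runWith_eq_some_iff (b : β) :
    ∀ (k : ℕ) (as : List (List Bool)),
      runWith M x ans k as = some b ↔ ∃ j < k, M.step x ((nextT M x ans)^[j] as) = Sum.inr b
  | 0, as => by simp [runWith]
  | k + 1, as => by
    rw [runWith]
    cases h : M.step x as with
    | inr b' =>
      simp only [Option.some.injEq]
      have hfix : ∀ j, (nextT M x ans)^[j] as = as := by
        intro j
        induction j with
        | zero => rfl
        | succ j ih => rw [Function.iterate_succ_apply', ih, nextT_of_inr M x ans h]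
      constructor
      · rintro rfl; exact ⟨0, Nat.succ_pos _, by simp [h]⟩
      · rintro ⟨j, -, hj⟩
        rw [hfix j, h] at hj
        exact Sum.inr_injective hj
    | inl u =>
      simp only
      rw [runWith_eq_some_iff b k]
      constructor
      · rintro ⟨j, hj, hstep⟩
        refine ⟨j + 1, Nat.succ_lt_succ hj, ?_⟩
        rwa [Function.iterate_succ_apply, nextT_of_inl M x ans h]
      · rintro ⟨j, hj, hstep⟩
        cases j with
        | zero => simp [h] at hstep
        | succ j =>
          refine ⟨j, Nat.lt_of_succ_lt_succ hj, ?_⟩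
          rwa [Function.iterate_succ_apply, nextT_of_inl M x ans h] at hstep

/-- The transcript after `j` rounds is the `j`-th iterate of the dynamics. [folklore] -/
theorem traceT_eq_iterate (j : ℕ) : traceT M x ans j = (nextT M x ans)^[j] [] := by
  induction j with
  | zero => rfl
  | succ j ih => rw [traceT_succ, ih, Function.iterate_succ_apply']

/-- Once the machine outputs, the transcript is frozen. [folklore] -/
theorem traceT_eq_of_inr {j : ℕ} {b : β} (h : M.step x (traceT M x ans j) = Sum.inr b) :
    ∀ j', j ≤ j' → traceT M x ans j' = traceT M x ans j := by
  intro j' hj'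
  induction hj' with
  | refl => rfl
  | step _ ih => rw [traceT_succ, ih, nextT_of_inr M x ans h]

/-- The run outputs `b` within `k ≥ 1` rounds iff after `k - 1` rounds the machine reports `b`. [folklore] -/
theorem runWith_nil_eq_some_iff {k : ℕ} (hk : 0 < k) (b : β) :
    runWith M x ans k [] = some b ↔ M.step x (traceT M x ans (k - 1)) = Sum.inr b := by
  rw [runWith_eq_some_iff]
  constructor
  · rintro ⟨j, hj, hstep⟩
    rw [← traceT_eq_iterate] at hstep
    rw [traceT_eq_of_inr M x ans hstep (k - 1) (by omega)]
    exact hstep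
  · intro h
    exact ⟨k - 1, by omega, by rwa [← traceT_eq_iterate]⟩

/-- The transcript has at most one entry per round. [folklore] -/
theorem length_traceT_le (j : ℕ) : (traceT M x ans j).length ≤ j := by
  induction j with
  | zero => simp
  | succ j ih =>
    rw [traceT_succ, nextT]
    cases M.step x (traceT M x ans j) with
    | inl u => simp; omega
    | inr b => simp only; omega

/-- If the machine still queries after `j` rounds, every round so far appended an answer. [folklore] -/
theorem length_traceT_of_inl {j : ℕ} {u : List Bool} (h : M.step x (traceT M x ans j) = Sum.inl u) :
    (traceT M x ans j).length = j := by
  induction j generalizing u with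
  | zero => simp
  | succ j ih =>
    rw [traceT_succ] at h ⊢
    cases h' : M.step x (traceT M x ans j) with
    | inr b =>
      rw [nextT_of_inr M x ans h'] at h
      rw [h'] at h; cases h
    | inl u' =>
      rw [nextT_of_inl M x ans h']
      simp [ih h']

/-- The transcript grows: `traceT j` is a prefix of `traceT (j+1)`. [folklore] -/
theorem traceT_prefix_succ (j : ℕ) : traceT M x ans j <+: traceT M x ans (j + 1) := by
  rw [traceT_succ, nextT]
  cases M.step x (traceT M x ans j) with
  | inl u => exact List.prefix_append _ _
  | inr b => exact List.prefix_rfl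

/-- **Well-formedness of transcripts**: every entry of the transcript is the (bracketed) answer,
by the rule, to the query the machine asked at that point. [folklore] -/
theorem traceT_wf (j : ℕ) :
    ∀ i < (traceT M x ans j).length, ∃ u, M.step x ((traceT M x ans j).take i) = Sum.inl u ∧
      (traceT M x ans j)[i]? = some [ans ((traceT M x ans j).take i) u] := by
  induction j with
  | zero => simp
  | succ j ih =>
    intro i hi
    rw [traceT_succ] at hi ⊢
    cases h : M.step x (traceT M x ans j) with
    | inr b =>
      rw [nextT_of_inr M x ans h] at hi ⊢
      exact ih i hi
    | inl u =>
      rw [nextT_of_inl M x ans h] at hi ⊢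
      simp only [List.length_append, List.length_singleton] at hi
      rcases Nat.lt_succ_iff_lt_or_eq.1 hi with hi | rfl
      · obtain ⟨u', h1, h2⟩ := ih i hi
        refine ⟨u', ?_, ?_⟩
        · rwa [List.take_append_of_le_length hi.le]
        · rw [List.take_append_of_le_length hi.le, List.getElem?_append_left hi, h2]
      · refine ⟨u, ?_, ?_⟩
        · rw [List.take_left']; · exact h
          rfl
        · rw [List.take_left' rfl]; simp

/-- **Locality of transcripts**: an answer rule that agrees with `a₁` on the queries actually
asked along the transcript of `a₁` produces the same transcript. [cite: AroraBarak2009, §3.4] -/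
theorem traceT_congr (a₁ a₂ : List (List Bool) → List Bool → Bool) :
    ∀ j : ℕ, (∀ i < (traceT M x a₁ j).length, ∀ u,
      M.step x ((traceT M x a₁ j).take i) = Sum.inl u →
        a₁ ((traceT M x a₁ j).take i) u = a₂ ((traceT M x a₁ j).take i) u) →
      traceT M x a₂ j = traceT M x a₁ j
  | 0, _ => rfl
  | j + 1, H => by
    have hpre : ∀ i ≤ (traceT M x a₁ j).length,
        (traceT M x a₁ (j + 1)).take i = (traceT M x a₁ j).take i := by
      intro i hi
      rw [traceT_succ, nextT]
      cases M.step x (traceT M x a₁ j) with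
      | inl u => exact List.take_append_of_le_length hi
      | inr b => rfl
    have hlen : (traceT M x a₁ j).length ≤ (traceT M x a₁ (j + 1)).length :=
      (traceT_prefix_succ M x a₁ j).length_le
    have IH : traceT M x a₂ j = traceT M x a₁ j := by
      refine traceT_congr a₁ a₂ j fun i hi u hu => ?_
      have h1 := H i (lt_of_lt_of_le hi hlen) u (by rwa [hpre i hi.le])
      rwa [hpre i hi.le] at h1
    rw [traceT_succ, traceT_succ, IH]
    cases h : M.step x (traceT M x a₁ j) with
    | inr b => rw [nextT_of_inr M x a₁ h, nextT_of_inr M x a₂ h]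
    | inl u =>
      rw [nextT_of_inl M x a₁ h, nextT_of_inl M x a₂ h]
      have hl : (traceT M x a₁ j).length < (traceT M x a₁ (j + 1)).length := by
        rw [traceT_succ, nextT_of_inl M x a₁ h]; simp
      have h2 := H _ hl u (by rw [hpre _ le_rfl, List.take_length]; exact h)
      rw [hpre _ le_rfl, List.take_length] at h2
      rw [h2]

/-- Entries of a transcript are single bits. [folklore] -/
theorem traceT_entries (j : ℕ) : ∀ a ∈ traceT M x ans j, ∃ c : Bool, a = [c] := by
  intro a ha
  obtain ⟨i, hi, hia⟩ := List.getElem_of_mem ha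
  obtain ⟨u, -, h2⟩ := traceT_wf M x ans j i hi
  rw [List.getElem?_eq_getElem hi, hia] at h2
  exact ⟨_, Option.some_injective _ h2⟩

/-- **G01's runner against a language oracle is `runWith`** for the history-free rule
`u ↦ [u ∈ A]` (the oracle `Oracle.ofLanguage A` answers the one-symbol string
`encodeBool [u ∈ A]`). [folklore] -/
theorem runAux_ofLanguage (A : Language Bool) :
    ∀ (k : ℕ) (as : List (List Bool)),
      M.runAux (Oracle.ofLanguage A) x k as = runWith M x (fun _ u => A.boolIndicator u) k as
  | 0, _ => rfl
  | k + 1, as => by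
    rw [runAux_succ, runWith]
    cases M.step x as with
    | inl q => exact runAux_ofLanguage A k _
    | inr b => rfl

/-- Hence membership of `L` in `P^A` is witnessed by `runWith` runs: the defining clause of
`PRel (Oracle.ofLanguage A)` for the machine `M` reads
`runWith M x [· ∈ A] (q |x|) [] = some [x ∈ L]`. [folklore] -/
theorem run_ofLanguage_eq_runWith (A : Language Bool) (k : ℕ) :
    M.run (Oracle.ofLanguage A) k x = runWith M x (fun _ u => A.boolIndicator u) k [] :=
  runAux_ofLanguage M x A k []

/-! ### The lazy-sampling answer rule -/

/-- The query asked by `M` on `x` after the first `i` answers of `as` (if it asks one). [folklore] -/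
def queryAt (M : OracleAlg β) (x : List Bool) (as : List (List Bool)) (i : ℕ) : Option (List Bool) :=
  match M.step x (as.take i) with
  | Sum.inl u => some u
  | Sum.inr _ => none

/-- The cached answer to `u`: the first bit recorded in `as` at a round where `M` asked `u`. [folklore] -/
def cachedAnswer (M : OracleAlg β) (x : List Bool) (as : List (List Bool)) (u : List Bool) :
    Option Bool :=
  ((List.range as.length).find? fun i => queryAt M x as i = some u).map
    fun i => (as[i]?.getD []).headD false

/-- **The lazy-sampling rule** with the finite table `τ` on `F` hard-wired and coins `y`: a query in
`F` is answered by the table, a repeated query by its cached answer, and a fresh query at round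
`|as|` by the coin `y[|as|]`. [cite: BookVollmerWagner1996, §3 Prop. 1 (p. 373–374)] -/
def coinAns (M : OracleAlg β) (F : Finset (List Bool)) (τ : F → Bool) (x y : List Bool)
    (as : List (List Bool)) (u : List Bool) : Bool :=
  if h : u ∈ F then τ ⟨u, h⟩ else (cachedAnswer M x as u).getD (y.getD as.length false)

variable {M x}

/-- Unfolding lemma for `queryAt`. [folklore] -/
theorem queryAt_eq_some_iff {as : List (List Bool)} {i : ℕ} {u : List Bool} :
    queryAt M x as i = some u ↔ M.step x (as.take i) = Sum.inl u := by
  unfold queryAt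
  cases M.step x (as.take i) <;> simp

/-- No cached answer iff the query was never asked along `as`. [folklore] -/
theorem cachedAnswer_eq_none_iff {as : List (List Bool)} {u : List Bool} :
    cachedAnswer M x as u = none ↔ ∀ i < as.length, M.step x (as.take i) ≠ Sum.inl u := by
  simp [cachedAnswer, List.find?_eq_none, queryAt_eq_some_iff]

/-- **Consistency**: along the transcript of a history-free rule `O`, the cached answer is `O`'s. [folklore] -/
theorem cachedAnswer_traceT_historyFree (O : List Bool → Bool) (j : ℕ) {u : List Bool} {c : Bool}
    (h : cachedAnswer M x (traceT M x (fun _ v => O v) j) u = some c) : c = O u := by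
  unfold cachedAnswer at h
  set as := traceT M x (fun _ v => O v) j with has
  obtain ⟨i, hi, rfl⟩ := Option.map_eq_some_iff.1 h
  have hi1 := List.find?_some hi
  have hi2 : i ∈ List.range as.length := List.mem_of_find?_eq_some hi
  simp only [decide_eq_true_eq, queryAt_eq_some_iff] at hi1
  rw [List.mem_range] at hi2
  obtain ⟨u', h1, h2⟩ := traceT_wf M x (fun _ v => O v) j i hi2
  rw [← has] at h1 h2
  rw [hi1] at h1
  cases h1
  rw [h2]
  simp

/-- Table queries are answered by the table. [folklore] -/
theorem coinAns_of_mem {F : Finset (List Bool)} (τ : F → Bool) {y : List Bool} {as : List (List Bool)}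
    {u : List Bool} (h : u ∈ F) : coinAns M F τ x y as u = τ ⟨u, h⟩ := by
  simp [coinAns, h]

/-- Repeated queries are answered from the cache. [folklore] -/
theorem coinAns_of_cached {F : Finset (List Bool)} (τ : F → Bool) {y : List Bool}
    {as : List (List Bool)} {u : List Bool} (h : u ∉ F) {c : Bool}
    (hc : cachedAnswer M x as u = some c) : coinAns M F τ x y as u = c := by
  simp [coinAns, h, hc]

/-- Fresh queries are answered by the coin of the current round. [folklore] -/
theorem coinAns_of_fresh {F : Finset (List Bool)} (τ : F → Bool) {y : List Bool}
    {as : List (List Bool)} {u : List Bool} (h : u ∉ F)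
    (hc : cachedAnswer M x as u = none) : coinAns M F τ x y as u = y.getD as.length false := by
  simp [coinAns, h, hc]

/-- The lazy-sampling rule reads only the coin at position `|as|`. [folklore] -/
theorem coinAns_congr_coins {F : Finset (List Bool)} (τ : F → Bool) {y y' : List Bool}
    {as : List (List Bool)} (u : List Bool) (hy : y.getD as.length false = y'.getD as.length false) :
    coinAns M F τ x y as u = coinAns M F τ x y' as u := by
  unfold coinAns
  rw [hy]

/-- **Coin locality**: the transcript after `j` rounds only depends on the first `j` coins. [folklore] -/
theorem traceT_coinAns_congr {F : Finset (List Bool)} (τ : F → Bool) {y y' : List Bool} (j : ℕ)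
    (hy : ∀ i < j, y.getD i false = y'.getD i false) :
    traceT M x (coinAns M F τ x y') j = traceT M x (coinAns M F τ x y) j := by
  refine traceT_congr M x _ _ j fun i hi u _ => coinAns_congr_coins τ u ?_
  have hij : i < j := lt_of_lt_of_le hi (length_traceT_le M x _ j)
  rw [List.length_take_of_le hi.le]
  exact hy i hij

/-! ### A counting lemma: halving by an involution -/

/-- If an involution `φ` of `Ω` preserves `P` and flips the bit `g`, then exactly half of the
elements of `Ω` satisfying `P` have `g = c`. [folklore] -/
theorem two_mul_card_filter_eq {S : Type*} (Ω : Finset S) (φ : S → S)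
    (hφΩ : ∀ s ∈ Ω, φ s ∈ Ω) (hφφ : ∀ s, φ (φ s) = s) (P : S → Prop) [DecidablePred P]
    (hP : ∀ s, P s → P (φ s)) (g : S → Bool) (hg : ∀ s, g (φ s) = !g s) (c : Bool) :
    2 * (Ω.filter fun s => P s ∧ g s = c).card = (Ω.filter P).card := by
  have hsplit := Finset.card_filter_add_card_filter_not (s := Ω.filter P) (fun s => g s = c)
  rw [Finset.filter_filter, Finset.filter_filter] at hsplit
  have hbij : (Ω.filter fun s => P s ∧ ¬g s = c).card = (Ω.filter fun s => P s ∧ g s = c).card := by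
    refine Finset.card_nbij' φ φ (fun s hs => ?_) (fun s hs => ?_) (fun s _ => hφφ s) (fun s _ => hφφ s)
    · simp only [Finset.mem_coe, Finset.mem_filter] at hs ⊢
      refine ⟨hφΩ s hs.1, hP s hs.2.1, ?_⟩
      rw [hg]; revert hs; cases g s <;> cases c <;> simp
    · simp only [Finset.mem_coe, Finset.mem_filter] at hs ⊢
      refine ⟨hφΩ s hs.1, hP s hs.2.1, ?_⟩
      rw [hg, hs.2.2]; cases c <;> simp
  omega

end OracleAlg

end Literature.Computability.Complexity
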